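import Mathlib.Analysis.InnerProductSpace.Adjoint
import Mathlib.Analysis.InnerProductSpace.Projection.Basic
import HarnessLib

/-!
# Route `UnitScaleTilt`, crux K1 «MinimiserStabilityRegPr» (stmt-QuantumFields-19200), leaf V2′ `stub_halvingStep` — branch (P2-small) «H-SMALL», mechanism (α)
# COVERING ∕ PERIODISATION (★★OWNER RULING g26-№18): **brick α3-CORE — ADJOINTS AND ORTHOGONAL PROJECTIONS INTERTWINE WITH A PULLBACK AS SOON AS THE FORWARD
# MAPS INTERTWINE WITH ITS PUSHFORWARD** (abstract Hilbert-space bookkeeping for `∂* = adjoint ∂`, `Q* = adjoint Q` and the gauge-fixing projection `R` of (2.19))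

Cell `ym3-torus` (HUMAN RULING D-0037, YM ladder rung R3 — continuum SU(2) YM₃ on the torus is a RUNG, not the Clay problem), width seat `ym-ust-19200-w5` gen 3
(LEAD (S3), H-SMALL planner).  `--supports stmt-QuantumFields-19200 --as helper`; def-free, 0 sorry, standard axioms; Mathlib only.

THE POINT (memo `H-SMALL-PLAN-w5g3.md` = 19200 evidence #54 §3; bus 08:28Z α3 SPEC).  The covering map `π` of a small member by its `L^{j}`-fold cover gives PULLBACKS
`π^*` (periodic extension) and PUSHFORWARDS `π_*` (fibre sums), adjoint to each other for the `ℓ²` pairings.  Local FORWARD stencils (`∂`, `∂*`-as-a-stencil, curl,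
`Q`, `Q′`, Laplacian) intertwine with both by their formulas (brick α3a∕b).  This file supplies, abstractly and once:
* `adjoint_intertwine_of_push` — if `T (ρ₁ v) = ρ₂ (T′ v)` (forward map vs pushforwards) then `T′† (π₂ g) = π₁ (T† g)` (adjoints vs pullbacks): gives
  `dcsE`∕`QsE`∕`QpsE` of [Balaban1984PropagatorsII] Sect. A from `dcE`∕`QE`∕`QpE`;
* `mem_orthogonal_map_of_push` — if `ρ(K′) ⊆ K` then `π(Kᗮ) ⊆ K′ᗮ`;
* ★ `starProjection_intertwine` — if `π(K) ⊆ K′` and `π(Kᗮ) ⊆ K′ᗮ` then `K′.starProjection (π v) = π (K.starProjection v)`: gives the gauge-fixing projection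
  `RE D c = (KE D c).starProjection` inside `Δ_a = ∂*∂ + ∂R∂* + Q*aQ`, hence (with ✓`CoverFlatOps.deltaAE_intertwine_of_summands` and ✓α4-core
  `hOp_intertwine`) the key lemma `flatH D̃ (X∘π) = (flatH D X)∘π` of the branch.
NOT a claim about the mass gap.

References: T. Bałaban, CMP **96** (1984) 223–250 [Balaban1984PropagatorsII] ((2.14)–(2.19) pp.225–226, (2.35) p.228).
-/

noncomputable section

open scoped InnerProductSpace

namespace Summit.QuantumFields.YangMills.Theorems.CoverFlatOps

variable {E₁ E₂ E₁' E₂' : Type*}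
  [NormedAddCommGroup E₁] [InnerProductSpace ℝ E₁] [FiniteDimensional ℝ E₁]
  [NormedAddCommGroup E₂] [InnerProductSpace ℝ E₂] [FiniteDimensional ℝ E₂]
  [NormedAddCommGroup E₁'] [InnerProductSpace ℝ E₁'] [FiniteDimensional ℝ E₁']
  [NormedAddCommGroup E₂'] [InnerProductSpace ℝ E₂'] [FiniteDimensional ℝ E₂']

/-- **ADJOINTS INTERTWINE WITH PULLBACKS WHEN THE FORWARD MAPS INTERTWINE WITH PUSHFORWARDS.**  `π₁, π₂` pullbacks, `ρ₁, ρ₂` pushforwards (`⟪π f, g⟫ = ⟪f, ρ g⟫`),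
`T` downstairs, `T′` upstairs with `T (ρ₁ v) = ρ₂ (T′ v)`; then `T′† (π₂ g) = π₁ (T† g)`. [cite: Balaban1984PropagatorsII, (2.15) p.225, (2.18)-(2.19) p.226] -/
theorem adjoint_intertwine_of_push (T : E₁ →ₗ[ℝ] E₂) (T' : E₁' →ₗ[ℝ] E₂') (π₁ : E₁ →ₗ[ℝ] E₁') (π₂ : E₂ →ₗ[ℝ] E₂')
    (ρ₁ : E₁' →ₗ[ℝ] E₁) (ρ₂ : E₂' →ₗ[ℝ] E₂)
    (h₁ : ∀ (f : E₁) (g : E₁'), ⟪π₁ f, g⟫_ℝ = ⟪f, ρ₁ g⟫_ℝ) (h₂ : ∀ (f : E₂) (g : E₂'), ⟪π₂ f, g⟫_ℝ = ⟪f, ρ₂ g⟫_ℝ)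
    (hT : ∀ v : E₁', T (ρ₁ v) = ρ₂ (T' v)) (g : E₂) :
    LinearMap.adjoint T' (π₂ g) = π₁ (LinearMap.adjoint T g) := by
  refine ext_inner_right ℝ fun v => ?_
  rw [LinearMap.adjoint_inner_left, h₂, ← hT, ← LinearMap.adjoint_inner_left, h₁]

omit [FiniteDimensional ℝ E₁] [FiniteDimensional ℝ E₁'] in
/-- **`ρ(K′) ⊆ K` GIVES `π(Kᗮ) ⊆ K′ᗮ`** (pullback of the orthogonal complement, via the adjoint pushforward). [cite: Balaban1984PropagatorsII, (2.16)-(2.17) p.225] -/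
theorem mem_orthogonal_map_of_push (K : Submodule ℝ E₁) (K' : Submodule ℝ E₁') (π₁ : E₁ →ₗ[ℝ] E₁') (ρ₁ : E₁' →ₗ[ℝ] E₁)
    (h₁ : ∀ (f : E₁) (g : E₁'), ⟪π₁ f, g⟫_ℝ = ⟪f, ρ₁ g⟫_ℝ) (hρ : ∀ k' ∈ K', ρ₁ k' ∈ K) {q : E₁} (hq : q ∈ Kᗮ) :
    π₁ q ∈ K'ᗮ := by
  rw [Submodule.mem_orthogonal]
  intro k' hk'
  rw [real_inner_comm, h₁, real_inner_comm]
  exact (Submodule.mem_orthogonal K q).mp hq _ (hρ k' hk')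

omit [FiniteDimensional ℝ E₁] [FiniteDimensional ℝ E₁'] in
/-- ★ **ORTHOGONAL PROJECTIONS INTERTWINE WITH A PULLBACK THAT RESPECTS THE SUBSPACE AND ITS COMPLEMENT**: `π(K) ⊆ K′`, `π(Kᗮ) ⊆ K′ᗮ` ⇒
`P_{K′}(π v) = π(P_K v)` — the gauge-fixing projection `R` of (2.19) on a cover. [cite: Balaban1984PropagatorsII, (2.16)-(2.19) pp.225-226] -/
theorem starProjection_intertwine (K : Submodule ℝ E₁) (K' : Submodule ℝ E₁') [K.HasOrthogonalProjection] [K'.HasOrthogonalProjection]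
    (π₁ : E₁ →ₗ[ℝ] E₁') (hK : ∀ k ∈ K, π₁ k ∈ K') (hKo : ∀ q ∈ Kᗮ, π₁ q ∈ K'ᗮ) (v : E₁) :
    K'.starProjection (π₁ v) = π₁ (K.starProjection v) := by
  have hdec : π₁ v = π₁ (K.starProjection v) + π₁ (v - K.starProjection v) := by rw [← map_add, add_sub_cancel]
  have hmem : π₁ (K.starProjection v) ∈ K' := hK _ (Submodule.starProjection_apply_mem K v)
  have horth : π₁ (v - K.starProjection v) ∈ K'ᗮ := hKo _ (Submodule.sub_starProjection_mem_orthogonal v)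
  rw [hdec, map_add, Submodule.starProjection_eq_self_iff.mpr hmem, (Submodule.starProjection_apply_eq_zero_iff K').mpr horth, add_zero]

omit [FiniteDimensional ℝ E₁] [FiniteDimensional ℝ E₁'] in
/-- The same with the complement condition supplied by a pushforward (`mem_orthogonal_map_of_push`). [cite: Balaban1984PropagatorsII, (2.16)-(2.19) pp.225-226] -/
theorem starProjection_intertwine_of_push (K : Submodule ℝ E₁) (K' : Submodule ℝ E₁') [K.HasOrthogonalProjection] [K'.HasOrthogonalProjection]
    (π₁ : E₁ →ₗ[ℝ] E₁') (ρ₁ : E₁' →ₗ[ℝ] E₁) (h₁ : ∀ (f : E₁) (g : E₁'), ⟪π₁ f, g⟫_ℝ = ⟪f, ρ₁ g⟫_ℝ)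
    (hK : ∀ k ∈ K, π₁ k ∈ K') (hρ : ∀ k' ∈ K', ρ₁ k' ∈ K) (v : E₁) :
    K'.starProjection (π₁ v) = π₁ (K.starProjection v) :=
  starProjection_intertwine K K' π₁ hK (fun _ hq => mem_orthogonal_map_of_push K K' π₁ ρ₁ h₁ hρ hq) v

omit [FiniteDimensional ℝ E₁] [FiniteDimensional ℝ E₂] [FiniteDimensional ℝ E₁'] [FiniteDimensional ℝ E₂'] in
/-- **COMPOSITES**: if `S` intertwines with pullbacks (`S′ (π₂ g) = π₃ (S g)`) and `T` does (`T′ (π₁ f) = π₂ (T f)`), so does `S ∘ T`. [folklore] -/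
theorem comp_intertwine {E₃ E₃' : Type*} [AddCommGroup E₃] [Module ℝ E₃] [AddCommGroup E₃'] [Module ℝ E₃']
    (T : E₁ →ₗ[ℝ] E₂) (T' : E₁' →ₗ[ℝ] E₂') (S : E₂ →ₗ[ℝ] E₃) (S' : E₂' →ₗ[ℝ] E₃')
    (π₁ : E₁ →ₗ[ℝ] E₁') (π₂ : E₂ →ₗ[ℝ] E₂') (π₃ : E₃ →ₗ[ℝ] E₃')
    (hT : ∀ f, T' (π₁ f) = π₂ (T f)) (hS : ∀ g, S' (π₂ g) = π₃ (S g)) (f : E₁) :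
    (S' ∘ₗ T') (π₁ f) = π₃ ((S ∘ₗ T) f) := by
  rw [LinearMap.comp_apply, LinearMap.comp_apply, hT, hS]

end Summit.QuantumFields.YangMills.Theorems.CoverFlatOps

end
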